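/- Copyright: the b2b-balaban cell (near-miss cell 7), T⁴-continuum CRUX team (coordinator ruling e34b3e0c item (2)),
seat t4-ne7b-formalise-leaf-06 (gen 30). Released under the licence of the surrounding project. -/
import Summits.QuantumFields.BalabanUV.T4Continuum.Spine.NE7b.BoxCollarHolonomy
import Summits.QuantumFields.BalabanUV.T4Continuum.Spine.NE7b.BoxNearFlatFilling

/-!
# The near-flat filling of a box from COLLAR-LOCAL data — the junction `BoxCollarHolonomy` × `BoxNearFlatFilling`
# (route NE7b R-H ∕ C-RH°, H1 (1′)+(BOX): the LOCALISATION of p.193's hypothesis)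

Cell `pub-balaban`, sub-cell `t4`, spine estimate NE7b (node U5c), candidate route R-H «Peierls healing map» (C-RH°; PRICING-NE7b
v10∕v11 KILL-CANDIDATE — this file claims NO route value). ROUTES-NE7b v7 item 1 (1′) ∕ (S-k5.5) display the competitor binder
`hcomp : ∃ U₀` filling the healing box, Wilson action `≤ c_fill²·diam(coll)⁴·a(e)²·ν`, `a(e)` = the amplitude of `e` ON THE COLLAR.
In the tree: `BoxNearFlatFilling` (leaf-06 g29) = print's p.193 construction `boxFill` (shell gauge, extend by `1`, undo the gauge),
near-flat under PRINT's hypothesis `ShellPlaqSmall` on whole shell HYPERPLANES (PRICING v11 F58 (ii): usable at `ε := ε_T` under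
(R-top), not at the collar amplitude — «H1's located gap NARROWS to the LOCALISATION of p.193's hypothesis»); `BoxCollarHolonomy`
(leaf-01 g29) = on the box collar `P₁ ∖ P₂ ⊂ ℤ^{n+3}` the tree gauge of [Bałaban, Large field I] p.196 ∕ [II] p.382
(`B16Ineq382.case1Hyp_gaugeFixed` + `norm_bond_sub_one_le`, the Literature typers' reproduction, BY NAME) makes every collar bond
`(5W² + dW)ε`-close to `1` when only the plaquettes with all four corners IN THE COLLAR are `ε`-small. THIS FILE composes them:
* §1 **`gaugeFill g U lo hi`** — p.193's extension step over an ARBITRARY gauge function `g` (pure gauge `g(y)⁻¹g(y + e_μ)` on the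
  bonds touching `[lo, hi]`, `U` elsewhere; `boxFill U lo hi = gaugeFill (shellGaugeFn U lo hi) U lo hi` by `rfl`) with
  `BoxNearFlatFilling` §2's plaquette algebra verbatim in `g`; §2 **sizes** (any `GaugeGroup`): if `g` makes the NON-touching bonds of
  the big box `[lo − 1, hi + 1]` `δ`-small, every big-box plaquette of the filling has `dist1 ≤ 4δ`, every plaquette (`i ≠ j`) is
  untouched or so bounded;
* §3 **the collar**: the non-touching bonds of `P₂`'s big box are collar bonds (`P₂ = [lo′, hi′]` strictly inside `P₁ = [lo, hi]`);
  leaf-01's bound TRANSFERRED to `H`-valued fields along `ι : H →* 𝔸ˣ` into `U1 𝔸` with `‖ι h − 1‖ = s h` (`treeGaugeFn (ι ∘ V) =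
  ι ∘ treeGaugeFn V` by `hol_map`): the `H`-valued gauge `g₀ := treeGaugeFn V lo hi lo′₁` has `s(V^{g₀}(b)) ≤ (5W² + dW)ε` on collar
  bonds (`size_gaugeAct_treeGauge_le`);
* §4 **HEADLINES**: **`collarFill U lo hi lo' hi' := gaugeFill (treeGaugeFn (curry U) lo hi lo′₁) U lo' hi'`**. Under `dist1 U(∂p) ≤ ε`
  for the plaquettes with all four corners IN THE COLLAR ONLY (`P₂ ≠ ∅` strictly inside `P₁`, sides of `P₁` of `≤ W + 1` sites):
  every plaquette with corners in `[lo′ − 1, hi′ + 1]` has `dist1 (collarFill U (∂p)) ≤ 4(5W² + dW)ε` and every plaquette is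
  untouched or so bounded (any `GaugeGroup` carrier with such an `ι`; **`sphere_norm_plaquette_collarFill_sub_one_le`** on `S³`,
  **`su_dist1_plaquette_collarFill_le`** on `SU(N)`); bonds not touching `P₂` are unchanged; on `S³` the Wilson action over any
  finset `T` of big-box plaquettes is `≤ #T·8(5W² + dW)²ε²` (**`sphere_action_sum_collarFill_le`**) — the `hcomp` shape with
  `a := ` the COLLAR amplitude, `c_fill·diam² = 4(5W² + dW) ≤ 24W²` for `W ≥ d` (`BoxCollarHolonomy.quadratic_le_six_sq`).

HONEST FRAMING. Law-free lattice gauge algebra on ONE configuration plus a by-name reading of a Literature reproduction the tree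
PROVES (`B16Ineq382`, `B15TreeGauge196`; nothing of pp.193∕196∕382 cited as a fact); nothing of bill A∕B, (JC), (MP<L²), H2∕H3,
(HULL), (TWIST) or any density of Bałaban's asserted; the ℤ^d collar is the UNWRAPPED case of (BOX). By-name ROUTE value: NIL
(PRICING v11 F51 — C-RH°'s import is the numerator extraction, not the filling); SUPPLIER-GRADE anatomy moving ONE configuration-
level census line, H1 (1′)+(BOX): «display inhabited at `ε_T`; LOCALISATION open» ↦ «inhabited at the collar-local `ε`» — the third
side of ROUTES v7 item 1's trichotomy next to `BoxCollarHolonomy` (box collar ⇒ no Type-II holonomy) and `HollowForcedFluxWitness`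
(hollow `H` ⇒ no near-flat filling; contrast on explicit data: `HollowVersusBoxFilling.no_flat_boxCollar_contains_whol_loop`). NE7b (`T4WeightBudget.RelWeightBound`) NOT PRINTED, NOT PROVED; spine PROVED 0∕9; rung (B)+1
on a FINITE torus T⁴ — NOT infinite volume, NOT the mass gap, NOT Clay. HONEST DEPENDENCY: continuum YM on T⁴ ⇐ BetaPertH ∧ nine
spine estimates (0/9 proved); BetaPertH ⇐ (D1) ∧ (D4) ∧ CAP+tail; G-an2-4 gates asym, D1 and NE2/3/4. POLICY: crux-route work under
`Spine/NE7b/`, the junction of two landed files (FREEZE (0) respected: not a `T4Continuum/Support` leaf, no folklore-algebra module);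
three concrete definitions (`gaugeExt`, `gaugeFill`, `collarFill`), no `Prop`-valued fact, no `[cite:]`.
-/

set_option autoImplicit false

namespace Summit.QuantumFields.BalabanUV.T4Continuum.NE7b.BoxCollarFilling

noncomputable section

open scoped Quaternion
open Literature.MathematicalPhysics.QuantumFieldTheory.Balaban1983to89 (GaugeGroup dist1)
open Literature.MathematicalPhysics.QuantumFieldTheory.Balaban1983to89.B7Prop1Explicit
  (e hol plaqWord gaugeAct U1 mem_U1)
open Literature.MathematicalPhysics.QuantumFieldTheory.Balaban1983to89.B8Lemma1NonAbelian (e_nonneg)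
open Literature.MathematicalPhysics.QuantumFieldTheory.Balaban1983to89.B15TreeGauge196 (ann box Geom i0 treeGaugeFn)
open Literature.MathematicalPhysics.QuantumFieldTheory.Balaban1983to89.B16Ineq382
  (PlaqSmallOn case1Hyp_gaugeFixed norm_bond_sub_one_le)
open Literature.MathematicalPhysics.QuantumFieldTheory (ZdEdge ZdGaugeConfig)
open Summit.QuantumFields.BalabanUV.T4Continuum.NE7b.NonAbelianStokesReading (curry plaquette_eq_hol_plaqWord sphereGaugeGroup)
open Summit.QuantumFields.BalabanUV.T4Continuum.NE7b.BoxNearFlatFilling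
  (touchingBonds mem_touchingBonds_iff bigBox_of_mem_box_between shellGaugeFn boxFill dist1_inv_mul_mul dist1_four_le
    one_sub_re_eq_half_norm_sub_one_sq)
open Summit.QuantumFields.BalabanUV.T4Continuum.NE7b.BoxCollarHolonomy
  (geom_collar hol_map plaqSmallOn_map unitSphereToUnits_mem_U1 toHomUnits_fundamentalRep_mem_U1
    norm_toHomUnits_fundamentalRep_sub_one)

variable {d : ℕ} {G : Type*}

/-! ## §1 The pure-gauge filling over an arbitrary gauge function (any group) -/

section AnyGroup

variable [Group G] (g : (Fin d → ℤ) → G) (U : ZdGaugeConfig d G) (lo hi : Fin d → ℤ)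

open scoped Classical in
/-- The GAUGED EXTENSION in the `g`-fixed picture: `1` on the bonds touching the box `[lo, hi]`, the `g`-gauged bond
variable `g(y)·U(y, μ)·g(y + e_μ)⁻¹` elsewhere (p.193's *«V′_k(b′) = 1 for b′ ∈ Λ»* over an arbitrary gauge function). -/
def gaugeExt (y : Fin d → ℤ) (μ : Fin d) : G :=
  if (y, μ) ∈ touchingBonds lo hi then 1 else gaugeAct g (curry U) y μ

open scoped Classical in
/-- **THE PURE-GAUGE FILLING** `gaugeFill g U lo hi : ZdGaugeConfig d G`: the pure gauge `g(y)⁻¹·g(y + e_μ)` on the bonds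
touching the box `[lo, hi]`, the given `U` on every other bond. -/
def gaugeFill : ZdGaugeConfig d G := fun b =>
  if b ∈ touchingBonds lo hi then (g b.1)⁻¹ * g (b.1 + e b.2) else U b

/-- **p.193 IS THE SPECIAL CASE `g := ` the shell gauge**: `boxFill U lo hi = gaugeFill (shellGaugeFn U lo hi) U lo hi`. -/
theorem boxFill_eq_gaugeFill : boxFill U lo hi = gaugeFill (shellGaugeFn U lo hi) U lo hi := rfl

/-- **THE FILLING KEEPS THE EXTERIOR DATA**: on a bond not touching the box, `gaugeFill g U = U`. -/
theorem gaugeFill_apply_of_not_touches {y : Fin d → ℤ} {μ : Fin d} (h : (y, μ) ∉ touchingBonds lo hi) :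
    gaugeFill g U lo hi (y, μ) = U (y, μ) := by
  simp only [gaugeFill, if_neg h]

/-- On a touching bond the filling is the pure gauge `g(y)⁻¹·g(y + e_μ)`. -/
theorem gaugeFill_apply_of_touches {y : Fin d → ℤ} {μ : Fin d} (h : (y, μ) ∈ touchingBonds lo hi) :
    gaugeFill g U lo hi (y, μ) = (g y)⁻¹ * g (y + e μ) := by
  simp only [gaugeFill, if_pos h]

/-- The filling is the `g⁻¹`-gauge transform of the gauged extension: `gaugeFill g U (y, μ) = g(y)⁻¹·E(y, μ)·g(y + e_μ)`. -/
theorem gaugeFill_apply_eq (y : Fin d → ℤ) (μ : Fin d) :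
    gaugeFill g U lo hi (y, μ) = (g y)⁻¹ * gaugeExt g U lo hi y μ * g (y + e μ) := by
  by_cases h : (y, μ) ∈ touchingBonds lo hi
  · rw [gaugeFill_apply_of_touches g U lo hi h, gaugeExt, if_pos h, mul_one]
  · rw [gaugeFill_apply_of_not_touches g U lo hi h, gaugeExt, if_neg h, gaugeAct]
    simp only [curry]
    group

/-- **A FILLED PLAQUETTE IS A CONJUGATED PRODUCT OF FOUR GAUGED BONDS (or `1`'s)**:
`gaugeFill g U (∂p_{ij}(x)) = g(x)⁻¹ · [E(x,i) E(x+eᵢ,j) E(x+eⱼ,i)⁻¹ E(x,j)⁻¹] · g(x)`, `E = gaugeExt g U lo hi`. -/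
theorem plaquette_gaugeFill_eq (x : Fin d → ℤ) (i j : Fin d) :
    ZdGaugeConfig.plaquette (gaugeFill g U lo hi) x i j =
      (g x)⁻¹ * (gaugeExt g U lo hi x i * gaugeExt g U lo hi (x + e i) j * (gaugeExt g U lo hi (x + e j) i)⁻¹ *
        (gaugeExt g U lo hi x j)⁻¹) * g x := by
  have h1 : (x + Pi.single i 1 : Fin d → ℤ) = x + e i := rfl
  have h2 : (x + Pi.single j 1 : Fin d → ℤ) = x + e j := rfl
  rw [ZdGaugeConfig.plaquette, h1, h2, gaugeFill_apply_eq, gaugeFill_apply_eq, gaugeFill_apply_eq, gaugeFill_apply_eq,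
    add_right_comm x (e j) (e i)]
  group

/-- A plaquette NONE of whose four bonds touches the box is unchanged by the filling. -/
theorem plaquette_gaugeFill_eq_of_forall_not_touches (x : Fin d → ℤ) (i j : Fin d)
    (h1 : (x, i) ∉ touchingBonds lo hi) (h2 : (x + e i, j) ∉ touchingBonds lo hi)
    (h3 : (x + e j, i) ∉ touchingBonds lo hi) (h4 : (x, j) ∉ touchingBonds lo hi) :
    ZdGaugeConfig.plaquette (gaugeFill g U lo hi) x i j = ZdGaugeConfig.plaquette U x i j := by
  have e1 : (x + Pi.single i 1 : Fin d → ℤ) = x + e i := rfl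
  have e2 : (x + Pi.single j 1 : Fin d → ℤ) = x + e j := rfl
  rw [ZdGaugeConfig.plaquette, ZdGaugeConfig.plaquette, e1, e2, gaugeFill_apply_of_not_touches g U lo hi h1,
    gaugeFill_apply_of_not_touches g U lo hi h2, gaugeFill_apply_of_not_touches g U lo hi h3,
    gaugeFill_apply_of_not_touches g U lo hi h4]

/-- On a touching bond the gauged extension is `1`. -/
theorem gaugeExt_of_touches {y : Fin d → ℤ} {μ : Fin d} (h : (y, μ) ∈ touchingBonds lo hi) :
    gaugeExt g U lo hi y μ = 1 := by
  simp only [gaugeExt, if_pos h]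

/-- **FLAT INSIDE**: a plaquette ALL of whose four bonds touch the box (e.g. any plaquette with a corner in the box) is
EXACTLY `1` after filling, whatever `g` is. -/
theorem plaquette_gaugeFill_eq_one_of_forall_touches (x : Fin d → ℤ) (i j : Fin d)
    (h1 : (x, i) ∈ touchingBonds lo hi) (h2 : (x + e i, j) ∈ touchingBonds lo hi)
    (h3 : (x + e j, i) ∈ touchingBonds lo hi) (h4 : (x, j) ∈ touchingBonds lo hi) :
    ZdGaugeConfig.plaquette (gaugeFill g U lo hi) x i j = 1 := by
  rw [plaquette_gaugeFill_eq, gaugeExt_of_touches g U lo hi h1, gaugeExt_of_touches g U lo hi h2,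
    gaugeExt_of_touches g U lo hi h3, gaugeExt_of_touches g U lo hi h4]
  group

end AnyGroup

/-! ## §2 Sizes (any `GaugeGroup`): untouched or `≤ 4δ` -/

section Sizes

variable [GaugeGroup G] (g : (Fin d → ℤ) → G) (U : ZdGaugeConfig d G) {lo hi : Fin d → ℤ} {δ : ℝ} (hδ : 0 ≤ δ)
  (hB : ∀ (y : Fin d → ℤ) (μ : Fin d), lo - 1 ≤ y → y + e μ ≤ hi + 1 → (y, μ) ∉ touchingBonds lo hi →
    dist1 (gaugeAct g (curry U) y μ) ≤ δ)
include hδ hB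

/-- **THE BOND BOUND**: if `g` makes every NON-touching bond of the big box `[lo − 1, hi + 1]` `δ`-small (`hB`), every bond of
the big box has `dist1 (gaugeExt g U y μ) ≤ δ` (the touching ones are `1`). -/
theorem dist1_gaugeExt_le {y : Fin d → ℤ} {μ : Fin d} (hy : lo - 1 ≤ y) (hyμ : y + e μ ≤ hi + 1) :
    dist1 (gaugeExt g U lo hi y μ) ≤ δ := by
  by_cases h : (y, μ) ∈ touchingBonds lo hi
  · rw [gaugeExt, if_pos h, GaugeGroup.dist1_one]; exact hδ
  · rw [gaugeExt, if_neg h]; exact hB y μ hy hyμ h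

/-- **EVERY PLAQUETTE OF THE BIG BOX IS NEAR-FLAT AFTER FILLING**: under `hB`, if the four corners of `p_{ij}(x)` lie in
`[lo − 1, hi + 1]` then `dist1 (gaugeFill g U (∂p)) ≤ 4δ`. -/
theorem dist1_plaquette_gaugeFill_le {x : Fin d → ℤ} {i j : Fin d} (hx : lo - 1 ≤ x) (hxij : x + e i + e j ≤ hi + 1) :
    dist1 (ZdGaugeConfig.plaquette (gaugeFill g U lo hi) x i j) ≤ 4 * δ := by
  have hi1 : x + e i ≤ hi + 1 := (le_add_of_nonneg_right (e_nonneg j)).trans hxij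
  have hj1 : x + e j ≤ hi + 1 := (le_add_of_nonneg_right (e_nonneg i)).trans (by rwa [add_right_comm] at hxij)
  have hxi : lo - 1 ≤ x + e i := hx.trans (le_add_of_nonneg_right (e_nonneg i))
  have hxj : lo - 1 ≤ x + e j := hx.trans (le_add_of_nonneg_right (e_nonneg j))
  have hxji : x + e j + e i ≤ hi + 1 := by rwa [add_right_comm]
  rw [plaquette_gaugeFill_eq, dist1_inv_mul_mul]
  exact dist1_four_le _ _ _ _ (dist1_gaugeExt_le g U hδ hB hx hi1) (dist1_gaugeExt_le g U hδ hB hxi hxij)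
    (dist1_gaugeExt_le g U hδ hB hxj hxji) (dist1_gaugeExt_le g U hδ hB hx hj1)

/-- **EVERY PLAQUETTE IS EITHER UNTOUCHED OR NEAR-FLAT** (`i ≠ j`): if none of its four bonds touches the box the filling
leaves it as it was; otherwise its four corners lie in the big box and `dist1 ≤ 4δ`. -/
theorem plaquette_gaugeFill_eq_or_dist1_le (x : Fin d → ℤ) {i j : Fin d} (hij : i ≠ j) :
    ZdGaugeConfig.plaquette (gaugeFill g U lo hi) x i j = ZdGaugeConfig.plaquette U x i j ∨
      dist1 (ZdGaugeConfig.plaquette (gaugeFill g U lo hi) x i j) ≤ 4 * δ := by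
  have hi0 := e_nonneg (d := d) i
  have hj0 := e_nonneg (d := d) j
  have hx1 : x ≤ x + e i := le_add_of_nonneg_right hi0
  have hx2 : x ≤ x + e j := le_add_of_nonneg_right hj0
  have hy1 : x + e i ≤ x + e i + e j := le_add_of_nonneg_right hj0
  have hx3 : x ≤ x + e i + e j := hx1.trans hy1
  have hy2 : x + e j ≤ x + e i + e j := by rw [add_right_comm]; exact le_add_of_nonneg_right hi0
  have hy3 : x + e j + e i = x + e i + e j := add_right_comm _ _ _
  by_cases h : (x, i) ∈ touchingBonds lo hi ∨ (x + e i, j) ∈ touchingBonds lo hi ∨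
      (x + e j, i) ∈ touchingBonds lo hi ∨ (x, j) ∈ touchingBonds lo hi
  · right
    have hr : lo - 1 ≤ x ∧ x + e i + e j ≤ hi + 1 := by
      simp only [mem_touchingBonds_iff] at h
      rcases h with (h | h) | (h | h) | (h | h) | (h | h)
      · exact bigBox_of_mem_box_between hij le_rfl hx3 h
      · exact bigBox_of_mem_box_between hij hx1 hy1 h
      · exact bigBox_of_mem_box_between hij hx1 hy1 h
      · exact bigBox_of_mem_box_between hij hx3 le_rfl h
      · exact bigBox_of_mem_box_between hij hx2 hy2 h
      · exact bigBox_of_mem_box_between hij (hy3 ▸ hx3) (hy3 ▸ le_rfl) h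
      · exact bigBox_of_mem_box_between hij le_rfl hx3 h
      · exact bigBox_of_mem_box_between hij hx2 hy2 h
    exact dist1_plaquette_gaugeFill_le g U hδ hB hr.1 hr.2
  · left
    simp only [not_or] at h
    exact plaquette_gaugeFill_eq_of_forall_not_touches g U lo hi x i j h.1 h.2.1 h.2.2.1 h.2.2.2

end Sizes

/-! ## §3 The box collar: geometry of the non-touching bonds, and leaf-01's tree gauge transferred to `G`-valued fields -/

section Collar

variable {n : ℕ} {lo hi lo' hi' : Fin (n + 3) → ℤ}

/-- A site of `P₂`'s big box `[lo′ − 1, hi′ + 1]` off `P₂ = [lo′, hi′]` lies in the collar `P₁ ∖ P₂` once `P₂` is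
strictly inside `P₁ = [lo, hi]`. -/
theorem mem_ann_of_bigBox (hlo : ∀ κ, lo κ < lo' κ) (hhi : ∀ κ, hi' κ < hi κ) {y : Fin (n + 3) → ℤ}
    (h1 : lo' - 1 ≤ y) (h2 : y ≤ hi' + 1) (h3 : ¬ (lo' ≤ y ∧ y ≤ hi')) : y ∈ ann lo hi lo' hi' := by
  refine ⟨⟨fun κ => ?_, fun κ => ?_⟩, h3⟩
  · have a := h1 κ; have b : lo κ + 1 ≤ lo' κ := Int.lt_iff_add_one_le.mp (hlo κ)
    simp only [Pi.sub_apply, Pi.one_apply] at a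
    linarith
  · have a := h2 κ; have b : hi' κ + 1 ≤ hi κ := Int.lt_iff_add_one_le.mp (hhi κ)
    simp only [Pi.add_apply, Pi.one_apply] at a
    linarith

/-- **THE NON-TOUCHING BONDS OF `P₂`'S BIG BOX ARE COLLAR BONDS**: both ends lie in `ann lo hi lo′ hi′`. -/
theorem mem_ann_of_not_touches (hlo : ∀ κ, lo κ < lo' κ) (hhi : ∀ κ, hi' κ < hi κ) {y : Fin (n + 3) → ℤ}
    {μ : Fin (n + 3)} (hy : lo' - 1 ≤ y) (hyμ : y + e μ ≤ hi' + 1) (h : (y, μ) ∉ touchingBonds lo' hi') :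
    y ∈ ann lo hi lo' hi' ∧ y + e μ ∈ ann lo hi lo' hi' := by
  rw [mem_touchingBonds_iff, not_or] at h
  exact ⟨mem_ann_of_bigBox hlo hhi hy ((le_add_of_nonneg_right (e_nonneg μ)).trans hyμ) h.1,
    mem_ann_of_bigBox hlo hhi (hy.trans (le_add_of_nonneg_right (e_nonneg μ))) hyμ h.2⟩

variable {H 𝔸 : Type*} [Group H] [NormedRing 𝔸] [NormOneClass 𝔸]

/-- **LEAF-01's TREE-GAUGE BOUND FOR `H`-VALUED FIELDS** along a hom `ι : H →* 𝔸ˣ` into `U1 𝔸` whose size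
`‖ι h − 1‖` is a given function `s` on `H`: on the box collar (`P₂ ≠ ∅` strictly inside `P₁`, sides of `P₁` of `≤ W + 1`
sites), if `s(V(∂p)) ≤ ε` for the plaquettes with all four corners in the collar, the `H`-VALUED tree gauge
`g₀ := treeGaugeFn V lo hi lo′₁` makes every collar bond satisfy `s(V^{g₀}(b)) ≤ (5W² + dW)·ε` — `B16Ineq382.case1Hyp_gaugeFixed`
+ `norm_bond_sub_one_le` BY NAME on `ι ∘ V`, pulled back by `treeGaugeFn (ι ∘ V) = ι ∘ treeGaugeFn V` (`hol_map`). -/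
theorem size_gaugeAct_treeGauge_le (ι : H →* 𝔸ˣ) (hι : ∀ h, ι h ∈ U1 𝔸) (s : H → ℝ)
    (hs : ∀ h, ‖((ι h : 𝔸ˣ) : 𝔸) - 1‖ = s h) (hlo : ∀ κ, lo κ < lo' κ) (hhi : ∀ κ, hi' κ < hi κ) (hP₂ : lo' ≤ hi')
    {W : ℕ} (hW : ∀ κ, hi κ - lo κ ≤ W) {V : (Fin (n + 3) → ℤ) → Fin (n + 3) → H} {ε : ℝ} (hε : 0 ≤ ε)
    (hP : ∀ (z : Fin (n + 3) → ℤ) (κ μ : Fin (n + 3)), κ ≠ μ → z ∈ ann lo hi lo' hi' → z + e κ ∈ ann lo hi lo' hi' →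
      z + e μ ∈ ann lo hi lo' hi' → z + e κ + e μ ∈ ann lo hi lo' hi' → s (hol V z (plaqWord κ μ)) ≤ ε)
    {x : Fin (n + 3) → ℤ} {μ : Fin (n + 3)} (hx : x ∈ ann lo hi lo' hi') (hx' : x + e μ ∈ ann lo hi lo' hi') :
    s (gaugeAct (treeGaugeFn V lo hi (lo' i0)) V x μ) ≤ (5 * (W : ℝ) ^ 2 + (n + 3) * W) * ε := by
  have hmap : ((ι (gaugeAct (treeGaugeFn V lo hi (lo' i0)) V x μ) : 𝔸ˣ) : 𝔸) =
      ((gaugeAct (treeGaugeFn (fun y ν => ι (V y ν)) lo hi (lo' i0)) (fun y ν => ι (V y ν)) x μ : 𝔸ˣ) : 𝔸) := by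
    simp only [gaugeAct, treeGaugeFn, map_mul, map_inv, hol_map]
  rw [← hs, hmap]
  exact norm_bond_sub_one_le
    (case1Hyp_gaugeFixed (geom_collar hlo hhi hP₂) hW (fun y ν => hι _) hε (plaqSmallOn_map ι s hs hP)) hx hx'

end Collar

/-! ## §4 The collar filling: headlines on the carriers of the `Spine/NE7b` files -/

section CollarFill

variable {n : ℕ}

/-- **THE COLLAR FILLING** of the hole `P₂ = [lo′, hi′]` of the box collar `P₁ ∖ P₂`: p.193's extension step run through
the collar's OWN tree gauge `treeGaugeFn (curry U) lo hi lo′₁` ([Large field I] p.196 ∕ [II] p.382) instead of the shell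
gauge of the whole exterior — pure gauge on the bonds touching `P₂`, `U` on every other bond. -/
def collarFill [Group G] (U : ZdGaugeConfig (n + 3) G) (lo hi lo' hi' : Fin (n + 3) → ℤ) : ZdGaugeConfig (n + 3) G :=
  gaugeFill (treeGaugeFn (curry U) lo hi (lo' i0)) U lo' hi'

/-- **THE COLLAR FILLING KEEPS EVERY BOND NOT TOUCHING THE HOLE** (in particular the whole collar and the exterior). -/
theorem collarFill_apply_of_not_touches [Group G] (U : ZdGaugeConfig (n + 3) G) (lo hi lo' hi' : Fin (n + 3) → ℤ)
    {y : Fin (n + 3) → ℤ} {μ : Fin (n + 3)} (h : (y, μ) ∉ touchingBonds lo' hi') :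
    collarFill U lo hi lo' hi' (y, μ) = U (y, μ) :=
  gaugeFill_apply_of_not_touches _ U lo' hi' h

variable {lo hi lo' hi' : Fin (n + 3) → ℤ} (hlo : ∀ κ, lo κ < lo' κ) (hhi : ∀ κ, hi' κ < hi κ) (hP₂ : lo' ≤ hi')
  {W : ℕ} (hW : ∀ κ, hi κ - lo κ ≤ W)
include hlo hhi hP₂ hW

section Hom

variable [GaugeGroup G] {𝔸 : Type*} [NormedRing 𝔸] [NormOneClass 𝔸] (ι : G →* 𝔸ˣ) (hι : ∀ g, ι g ∈ U1 𝔸)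
  (hs : ∀ g, ‖((ι g : 𝔸ˣ) : 𝔸) - 1‖ = dist1 g) (U : ZdGaugeConfig (n + 3) G) {ε : ℝ} (hε : 0 ≤ ε)
  (hP : ∀ (z : Fin (n + 3) → ℤ) (κ μ : Fin (n + 3)), κ ≠ μ → z ∈ ann lo hi lo' hi' → z + e κ ∈ ann lo hi lo' hi' →
    z + e μ ∈ ann lo hi lo' hi' → z + e κ + e μ ∈ ann lo hi lo' hi' → dist1 (ZdGaugeConfig.plaquette U z κ μ) ≤ ε)
include hι hs hε hP

/-- The collar's tree gauge makes every non-touching bond of the hole's big box `(5W² + dW)ε`-small in `dist1`. -/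
theorem dist1_gaugeAct_treeGauge_le_of_not_touches {y : Fin (n + 3) → ℤ} {μ : Fin (n + 3)} (hy : lo' - 1 ≤ y)
    (hyμ : y + e μ ≤ hi' + 1) (h : (y, μ) ∉ touchingBonds lo' hi') :
    dist1 (gaugeAct (treeGaugeFn (curry U) lo hi (lo' i0)) (curry U) y μ) ≤ (5 * (W : ℝ) ^ 2 + (n + 3) * W) * ε := by
  obtain ⟨h1, h2⟩ := mem_ann_of_not_touches hlo hhi hy hyμ h
  exact size_gaugeAct_treeGauge_le ι hι dist1 hs hlo hhi hP₂ hW hε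
    (fun z κ μ hκμ a b c d' => by rw [← plaquette_eq_hol_plaqWord]; exact hP z κ μ hκμ a b c d') h1 h2

/-- **(1′)+(BOX) AT THE COLLAR-LOCAL `ε`, ANY `GaugeGroup` CARRIER WITH A `U1` TRANSFER**: on the box collar (`P₂ ≠ ∅`
strictly inside `P₁ ⊂ ℤ^{n+3}`, sides of `P₁` of `≤ W + 1` sites), if the plaquettes with all four corners IN THE COLLAR have
`dist1 U(∂p) ≤ ε`, every plaquette with corners in the hole's big box `[lo′ − 1, hi′ + 1]` satisfies
`dist1 (collarFill U (∂p)) ≤ 4(5W² + dW)·ε`. -/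
theorem dist1_plaquette_collarFill_le_of_hom {x : Fin (n + 3) → ℤ} {i j : Fin (n + 3)} (hx : lo' - 1 ≤ x)
    (hxij : x + e i + e j ≤ hi' + 1) :
    dist1 (ZdGaugeConfig.plaquette (collarFill U lo hi lo' hi') x i j) ≤ 4 * ((5 * (W : ℝ) ^ 2 + (n + 3) * W) * ε) :=
  dist1_plaquette_gaugeFill_le _ U (by positivity)
    (fun _ _ hy hyμ h => dist1_gaugeAct_treeGauge_le_of_not_touches hlo hhi hP₂ hW ι hι hs U hε hP hy hyμ h) hx hxij

/-- **EVERY PLAQUETTE IS UNTOUCHED OR NEAR-FLAT** (`i ≠ j`) after the collar filling, same carrier and hypotheses. -/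
theorem plaquette_collarFill_eq_or_dist1_le_of_hom (x : Fin (n + 3) → ℤ) {i j : Fin (n + 3)} (hij : i ≠ j) :
    ZdGaugeConfig.plaquette (collarFill U lo hi lo' hi') x i j = ZdGaugeConfig.plaquette U x i j ∨
      dist1 (ZdGaugeConfig.plaquette (collarFill U lo hi lo' hi') x i j) ≤ 4 * ((5 * (W : ℝ) ^ 2 + (n + 3) * W) * ε) :=
  plaquette_gaugeFill_eq_or_dist1_le _ U (by positivity)
    (fun _ _ hy hyμ h => dist1_gaugeAct_treeGauge_le_of_not_touches hlo hhi hP₂ hW ι hι hs U hε hP hy hyμ h) x hij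

end Hom

section Sphere

variable (U : ZdGaugeConfig (n + 3) (Metric.sphere (0 : ℍ) 1)) {ε : ℝ} (hε : 0 ≤ ε)
  (hP : ∀ (z : Fin (n + 3) → ℤ) (κ μ : Fin (n + 3)), κ ≠ μ → z ∈ ann lo hi lo' hi' → z + e κ ∈ ann lo hi lo' hi' →
    z + e μ ∈ ann lo hi lo' hi' → z + e κ + e μ ∈ ann lo hi lo' hi' →
    ‖((ZdGaugeConfig.plaquette U z κ μ : Metric.sphere (0 : ℍ) 1) : ℍ) - 1‖ ≤ ε)
include hε hP

/-- **H1 (1′)+(BOX) INHABITED AT THE COLLAR-LOCAL `ε` ON THE PH-k CARRIER** (`S³`-valued configurations, plain norms):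
on the box collar, if every plaquette with its four corners IN THE COLLAR has `‖U(∂p) − 1‖ ≤ ε`, every plaquette with
corners in the hole's big box `[lo′ − 1, hi′ + 1]` satisfies `‖collarFill U (∂p) − 1‖ ≤ 4(5W² + dW)·ε`. -/
theorem sphere_norm_plaquette_collarFill_sub_one_le {x : Fin (n + 3) → ℤ} {i j : Fin (n + 3)} (hx : lo' - 1 ≤ x)
    (hxij : x + e i + e j ≤ hi' + 1) :
    ‖((ZdGaugeConfig.plaquette (collarFill U lo hi lo' hi') x i j : Metric.sphere (0 : ℍ) 1) : ℍ) - 1‖ ≤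
      4 * ((5 * (W : ℝ) ^ 2 + (n + 3) * W) * ε) := by
  letI : GaugeGroup (Metric.sphere (0 : ℍ) 1) := sphereGaugeGroup
  exact dist1_plaquette_collarFill_le_of_hom hlo hhi hP₂ hW (unitSphereToUnits ℍ) unitSphereToUnits_mem_U1
    (fun _ => rfl) U hε hP hx hxij

/-- **THE WILSON ACTION OF ONE FILLED PLAQUETTE**: `1 − re(collarFill U (∂p)) ≤ ½·(4(5W² + dW)ε)² = 8(5W² + dW)²ε²`. -/
theorem sphere_action_plaquette_collarFill_le {x : Fin (n + 3) → ℤ} {i j : Fin (n + 3)} (hx : lo' - 1 ≤ x)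
    (hxij : x + e i + e j ≤ hi' + 1) :
    1 - ((ZdGaugeConfig.plaquette (collarFill U lo hi lo' hi') x i j : Metric.sphere (0 : ℍ) 1) : ℍ).re ≤
      8 * (5 * (W : ℝ) ^ 2 + (n + 3) * W) ^ 2 * ε ^ 2 := by
  have h := sphere_norm_plaquette_collarFill_sub_one_le hlo hhi hP₂ hW U hε hP hx hxij
  have h0 : 0 ≤ ‖((ZdGaugeConfig.plaquette (collarFill U lo hi lo' hi') x i j : Metric.sphere (0 : ℍ) 1) : ℍ) - 1‖ :=
    norm_nonneg _
  rw [one_sub_re_eq_half_norm_sub_one_sq]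
  have h2 : ‖((ZdGaugeConfig.plaquette (collarFill U lo hi lo' hi') x i j : Metric.sphere (0 : ℍ) 1) : ℍ) - 1‖ ^ 2 ≤
      (4 * ((5 * (W : ℝ) ^ 2 + (n + 3) * W) * ε)) ^ 2 := pow_le_pow_left₀ h0 h 2
  nlinarith [h2]

/-- **THE `hcomp` SHAPE AT THE COLLAR AMPLITUDE** (ROUTES-NE7b v7 (S-k5.5) *«action `U₀ ≤ c_fill²·diam(coll)⁴·a(e)²·ν`»*,
`a(e)` the COLLAR amplitude): over any finite set `T` of plaquettes of the hole's big box, the Wilson action of the collar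
filling is at most `#T · 8(5W² + dW)²·ε²`. -/
theorem sphere_action_sum_collarFill_le (T : Finset ((Fin (n + 3) → ℤ) × Fin (n + 3) × Fin (n + 3)))
    (hT : ∀ t ∈ T, lo' - 1 ≤ t.1 ∧ t.1 + e t.2.1 + e t.2.2 ≤ hi' + 1) :
    ∑ t ∈ T, (1 - ((ZdGaugeConfig.plaquette (collarFill U lo hi lo' hi') t.1 t.2.1 t.2.2 :
        Metric.sphere (0 : ℍ) 1) : ℍ).re) ≤ T.card * (8 * (5 * (W : ℝ) ^ 2 + (n + 3) * W) ^ 2 * ε ^ 2) := by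
  calc ∑ t ∈ T, (1 - ((ZdGaugeConfig.plaquette (collarFill U lo hi lo' hi') t.1 t.2.1 t.2.2 :
        Metric.sphere (0 : ℍ) 1) : ℍ).re)
      ≤ ∑ t ∈ T, 8 * (5 * (W : ℝ) ^ 2 + (n + 3) * W) ^ 2 * ε ^ 2 :=
        Finset.sum_le_sum fun t ht =>
          sphere_action_plaquette_collarFill_le hlo hhi hP₂ hW U hε hP (hT t ht).1 (hT t ht).2
    _ = T.card * (8 * (5 * (W : ℝ) ^ 2 + (n + 3) * W) ^ 2 * ε ^ 2) := by rw [Finset.sum_const, nsmul_eq_mul]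

end Sphere

section SpecialUnitary

open scoped Matrix.Norms.L2Operator
open Literature.MathematicalPhysics.QuantumLattice (fundamentalRep)

variable {m : Type*} [Fintype m] [DecidableEq m] [Nonempty m]
  (U : ZdGaugeConfig (n + 3) (Matrix.specialUnitaryGroup m ℂ)) {ε : ℝ} (hε : 0 ≤ ε)
  (hP : ∀ (z : Fin (n + 3) → ℤ) (κ μ : Fin (n + 3)), κ ≠ μ → z ∈ ann lo hi lo' hi' → z + e κ ∈ ann lo hi lo' hi' →
    z + e μ ∈ ann lo hi lo' hi' → z + e κ + e μ ∈ ann lo hi lo' hi' → dist1 (ZdGaugeConfig.plaquette U z κ μ) ≤ ε)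
include hε hP

/-- **H1 (1′)+(BOX) INHABITED AT THE COLLAR-LOCAL `ε` ON `SU(N)`** (the cell's instance, `dist1 = ‖· − 1‖_{op}`): on the
box collar, if every plaquette with its four corners IN THE COLLAR has `dist1 U(∂p) ≤ ε`, every plaquette with corners in
the hole's big box satisfies `dist1 (collarFill U (∂p)) ≤ 4(5W² + dW)·ε`. -/
theorem su_dist1_plaquette_collarFill_le {x : Fin (n + 3) → ℤ} {i j : Fin (n + 3)} (hx : lo' - 1 ≤ x)
    (hxij : x + e i + e j ≤ hi' + 1) :
    dist1 (ZdGaugeConfig.plaquette (collarFill U lo hi lo' hi') x i j) ≤ 4 * ((5 * (W : ℝ) ^ 2 + (n + 3) * W) * ε) :=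
  dist1_plaquette_collarFill_le_of_hom hlo hhi hP₂ hW ((fundamentalRep m).toHomUnits) toHomUnits_fundamentalRep_mem_U1
    norm_toHomUnits_fundamentalRep_sub_one U hε hP hx hxij

end SpecialUnitary

end CollarFill

end

end Summit.QuantumFields.BalabanUV.T4Continuum.NE7b.BoxCollarFilling
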